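import Summits.Ventures.YMGap.Thresholds.OneLinkSDMeanTwo
import Summits.Ventures.YMGap.Thresholds.OneLinkPsiTwoGradientL2
import Summits.Ventures.YMGap.Thresholds.OneLinkRemainderIdentity
import Summits.Ventures.YMGap.Thresholds.OneLinkRemainderWords
import HarnessLib

/-!
# Venture YMGap — the one-link modulus beyond first order, part 20: the quadratic mean `E Re tr(gΔgΔ)` (the primitive `ω`)

HONEST FRAMING: venture file of the cell `pub-ymgap` (QuantumFields programme), strong-coupling LATTICE bookkeeping for `SU(N)`
lattice Yang–Mills; nothing about the continuum or the mass gap in the Clay sense.  No number of record (primitive `ω` of the cell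
note `HOME/p2/ONE-LINK-HIERARCHY.md` §4 (4.4)–(4.5)).

WHAT.  `ν_B(dg) ∝ exp(N Re tr(gB)) dg`, `‖B‖_op = r < 1/2`, `Z₁ = √∫‖tr(gB)‖²`, `Z₂ = √∫‖tr(gΔ)‖²`, `A_Δ = ‖E tr(gΔ)‖`, `a = 2N − 4/N`.
* `abs_integral_reTrQuad_DD_le` (`N ≥ 3`): from the Schwinger–Dyson identity `(a²−4) E Re tr(gΔgΔ) = N(a·G_w − 2·G_t)`
  (`OneLinkSDMeans.integral_reTrQuad_eq`) and the feedback rules,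
  `|E Re tr(gΔgΔ)| ≤ (Na/(a²−4))(2r‖Δ‖_F² + (2/N)‖Δ‖_F² Z₁) + (2N/(a²−4))(‖B‖_F‖Δ‖_F Z₂ + ‖B‖_F‖Δ‖_F A_Δ + 2r Z₂²)`;
* the pieces `abs_Gam_potB_quadDD_le`, `abs_integral_Gam_potB_quadDD_le` (`G_w`), `abs_integral_zw_le`, `abs_integral_Xzz_le`,
  `abs_integral_Gam_potB_prodDD_le` (`G_t`).  The `L²` gradient norm of `u + ψ₂` through `√((1+ω)/2)` is the next file
  (`OneLinkOmegaGradient`).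

References: cell note `HOME/p2/ONE-LINK-HIERARCHY.md` §4 (4.4)–(4.5); Shen–Zhu–Zhu CMP 400 (2023) §4.1.
-/

noncomputable section

open scoped Matrix ComplexConjugate BigOperators ContDiff Matrix.Norms.Frobenius
open Matrix Complex Finset MeasureTheory ProbabilityTheory
open Literature.MathematicalPhysics.QuantumFieldTheory
open Literature.MathematicalPhysics.QuantumFieldTheory.SUNBakryEmery

namespace Summit.Ventures.YMGap.OneLinkEigen

variable {N : ℕ}

/-- `∫ |f| ≤ √(∫ f²)` for continuous `f` under a probability measure on `SU(N)`. [folklore] -/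
theorem integral_abs_le_sqrt {f : SUN N → ℝ} (hf : Continuous f) (μ : Measure (SUN N)) [IsProbabilityMeasure μ] :
    ∫ x, |f x| ∂μ ≤ Real.sqrt (∫ x, f x ^ 2 ∂μ) := by
  have h := abs_integral_mul_le_sqrt (f := fun x => |f x|) (g := fun _ => (1 : ℝ)) (continuous_abs.comp hf) continuous_const μ
  have h1 : ∫ _ : SUN N, (1 : ℝ) ^ 2 ∂μ = 1 := by simp
  have e : (fun x => |f x| ^ 2) = fun x => f x ^ 2 := by funext x; rw [sq_abs]
  rw [h1, Real.sqrt_one, mul_one, e] at h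
  simp only [mul_one] at h
  exact (le_abs_self _).trans h

/-- Pointwise bound on the quadratic feedback `Γ(Re tr(·B), Re tr(QΔQΔ))` on `SU(N)`:
`|Γ| ≤ 2‖B‖_op‖Δ‖_F² + (2/N)‖Δ‖_F²|Im tr(Bg)|`. [folklore] -/
theorem abs_Gam_potB_quadDD_le (hN : N ≠ 0) (B Δ : Matrix (Fin N) (Fin N) ℂ) (g : SUN N) :
    |Gam (pot 1 B) (fun Q : Matrix (Fin N) (Fin N) ℂ => (Q * Δ * Q * Δ).trace.re) g| ≤
      2 * matrixOpNorm B * frobNorm Δ ^ 2 + 2 / N * frobNorm Δ ^ 2 * |(B * (g : Matrix (Fin N) (Fin N) ℂ)).trace.im| := by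
  have hNpos : (0 : ℝ) < N := Nat.cast_pos.2 (Nat.pos_of_ne_zero hN)
  have hg := SUN.mem_unitaryGroup g
  have hD0 := frobNorm_nonneg Δ
  have hr0 := matrixOpNorm_nonneg B
  set Q : Matrix (Fin N) (Fin N) ℂ := (g : Matrix (Fin N) (Fin N) ℂ) with hQ
  rw [Gam_potB_reTrQuad hN B Δ Δ g, ← hQ]
  have c1 : |(B * Q * Δ * Q * Δ * Q).trace.re| ≤ matrixOpNorm B * frobNorm Δ ^ 2 := by
    rw [show B * Q * Δ * Q * Δ * Q = (B * Q * Δ) * (Q * Δ * Q) by simp only [Matrix.mul_assoc]]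
    refine (abs_re_trace_mul_le _ _).trans ?_
    have h1 : frobNorm (B * Q * Δ) ≤ matrixOpNorm B * frobNorm Δ := by rw [hQ]; exact frobNorm_BgM_le B Δ g
    have h2 : frobNorm (Q * Δ * Q) = frobNorm Δ := by rw [frobNorm_mul_unitary _ hg, frobNorm_unitary_mul hg]
    rw [h2]
    calc frobNorm (B * Q * Δ) * frobNorm Δ ≤ (matrixOpNorm B * frobNorm Δ) * frobNorm Δ := mul_le_mul_of_nonneg_right h1 hD0
      _ = _ := by ring
  have c2 : |(Q * Δ * Bᴴ * Δ).trace.re| ≤ matrixOpNorm B * frobNorm Δ ^ 2 := by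
    rw [show Q * Δ * Bᴴ * Δ = (Q * Δ) * (Bᴴ * Δ) by simp only [Matrix.mul_assoc]]
    refine (abs_re_trace_mul_le _ _).trans ?_
    rw [frobNorm_unitary_mul hg]
    have h1 : frobNorm (Bᴴ * Δ) ≤ matrixOpNorm B * frobNorm Δ := by
      have := frobNorm_mul_le_matrixOpNorm_mul Bᴴ Δ; rwa [matrixOpNorm_conjTranspose] at this
    calc frobNorm Δ * frobNorm (Bᴴ * Δ) ≤ frobNorm Δ * (matrixOpNorm B * frobNorm Δ) := mul_le_mul_of_nonneg_left h1 hD0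
      _ = _ := by ring
  have c3 : |(Q * Δ * Q * Δ).trace.im| ≤ frobNorm Δ ^ 2 := by
    refine (abs_im_le_norm' _).trans ?_
    rw [show Q * Δ * Q * Δ = (Q * Δ) * (Q * Δ) by simp only [Matrix.mul_assoc]]
    refine (norm_trace_mul_le _ _).trans ?_
    rw [frobNorm_unitary_mul hg]; nlinarith [hD0]
  have e : -(1 / 2) * ((B * Q * Δ * Q * Δ * Q).trace.re + (B * Q * Δ * Q * Δ * Q).trace.re)
        + 1 / 2 * ((Q * Δ * Bᴴ * Δ).trace.re + (Q * Δ * Bᴴ * Δ).trace.re)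
        - 2 / N * (B * Q).trace.im * (Q * Δ * Q * Δ).trace.im =
      -(B * Q * Δ * Q * Δ * Q).trace.re + (Q * Δ * Bᴴ * Δ).trace.re - 2 / N * ((B * Q).trace.im * (Q * Δ * Q * Δ).trace.im) := by
    ring
  rw [e]
  have t3 : |2 / N * ((B * Q).trace.im * (Q * Δ * Q * Δ).trace.im)| ≤ 2 / N * frobNorm Δ ^ 2 * |(B * Q).trace.im| := by
    rw [abs_mul, abs_mul, abs_of_pos (by positivity : (0 : ℝ) < 2 / N)]
    have := mul_le_mul_of_nonneg_left c3 (abs_nonneg (B * Q).trace.im)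
    calc 2 / (N : ℝ) * (|(B * Q).trace.im| * |(Q * Δ * Q * Δ).trace.im|) ≤ 2 / N * (|(B * Q).trace.im| * frobNorm Δ ^ 2) :=
          mul_le_mul_of_nonneg_left this (by positivity)
      _ = _ := by ring
  calc _ ≤ |-(B * Q * Δ * Q * Δ * Q).trace.re + (Q * Δ * Bᴴ * Δ).trace.re| + |2 / N * ((B * Q).trace.im * (Q * Δ * Q * Δ).trace.im)| :=
        abs_sub _ _
    _ ≤ (|-(B * Q * Δ * Q * Δ * Q).trace.re| + |(Q * Δ * Bᴴ * Δ).trace.re|) + 2 / N * frobNorm Δ ^ 2 * |(B * Q).trace.im| :=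
        add_le_add (abs_add_le _ _) t3
    _ ≤ (matrixOpNorm B * frobNorm Δ ^ 2 + matrixOpNorm B * frobNorm Δ ^ 2) + 2 / N * frobNorm Δ ^ 2 * |(B * Q).trace.im| := by
        rw [abs_neg]; exact add_le_add (add_le_add c1 c2) le_rfl
    _ = _ := by ring

/-- `|∫ Γ(Re tr(·B), Re tr(QΔQΔ)) dν_B| ≤ 2‖B‖_op‖Δ‖_F² + (2/N)‖Δ‖_F² Z₁`. [folklore] -/
theorem abs_integral_Gam_potB_quadDD_le (hN : N ≠ 0) (B Δ : Matrix (Fin N) (Fin N) ℂ) :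
    |∫ g, Gam (pot 1 B) (fun Q : Matrix (Fin N) (Fin N) ℂ => (Q * Δ * Q * Δ).trace.re) g ∂(haarProbability (SUN N)).tilted (fun g => (N : ℝ) * ((g : Matrix (Fin N) (Fin N) ℂ) * B).trace.re)| ≤
      2 * matrixOpNorm B * frobNorm Δ ^ 2 + 2 / N * frobNorm Δ ^ 2 *
        Real.sqrt (∫ g, ‖((g : Matrix (Fin N) (Fin N) ℂ) * B).trace‖ ^ 2 ∂(haarProbability (SUN N)).tilted (fun g => (N : ℝ) * ((g : Matrix (Fin N) (Fin N) ℂ) * B).trace.re)) := by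
  have hNpos : (0 : ℝ) < N := Nat.cast_pos.2 (Nat.pos_of_ne_zero hN)
  have hD0 := frobNorm_nonneg Δ
  set ν : Measure (SUN N) := (haarProbability (SUN N)).tilted (fun g => (N : ℝ) * ((g : Matrix (Fin N) (Fin N) ℂ) * B).trace.re) with hν
  have hexpi : Integrable (fun g : SUN N => Real.exp ((N : ℝ) * ((g : Matrix (Fin N) (Fin N) ℂ) * B).trace.re))
      (haarProbability (SUN N)) :=
    integrable_of_continuous_SUN (Real.continuous_exp.comp (continuous_restrict (contDiff_pot (N : ℝ) B))) _
  haveI : IsProbabilityMeasure ν := isProbabilityMeasure_tilted hexpi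
  have hz1c : Continuous fun g : SUN N => ‖((g : Matrix (Fin N) (Fin N) ℂ) * B).trace‖ :=
    continuous_norm.comp ((continuous_subtype_val.matrix_mul continuous_const).matrix_trace)
  have hXc : Continuous fun g : SUN N => |(B * (g : Matrix (Fin N) (Fin N) ℂ)).trace.im| :=
    continuous_abs.comp (Complex.continuous_im.comp ((continuous_const.matrix_mul continuous_subtype_val).matrix_trace))
  have iX : Integrable (fun g : SUN N => |(B * (g : Matrix (Fin N) (Fin N) ℂ)).trace.im|) ν := integrable_of_continuous_SUN hXc ν
  have hX' : ∀ g : SUN N, |(B * (g : Matrix (Fin N) (Fin N) ℂ)).trace.im| ≤ ‖((g : Matrix (Fin N) (Fin N) ℂ) * B).trace‖ := by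
    intro g; rw [trace_mul_comm]; exact abs_im_le_norm' _
  have hintz1 : ∫ g, |(B * (g : Matrix (Fin N) (Fin N) ℂ)).trace.im| ∂ν ≤
      Real.sqrt (∫ g, ‖((g : Matrix (Fin N) (Fin N) ℂ) * B).trace‖ ^ 2 ∂ν) := by
    have h := integral_abs_le_sqrt hz1c ν
    simp only [abs_norm] at h
    exact le_trans (integral_mono iX (integrable_of_continuous_SUN hz1c ν) hX') h
  have hGc : Continuous fun g : SUN N => Gam (pot 1 B) (fun Q : Matrix (Fin N) (Fin N) ℂ => (Q * Δ * Q * Δ).trace.re) g :=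
    continuous_restrict (contDiff_Gam (contDiff_pot 1 B) (contDiff_reTrQuad Δ Δ))
  have iR : Integrable (fun g : SUN N => 2 * matrixOpNorm B * frobNorm Δ ^ 2
      + 2 / N * frobNorm Δ ^ 2 * |(B * (g : Matrix (Fin N) (Fin N) ℂ)).trace.im|) ν := (integrable_const _).add (iX.const_mul _)
  calc _ ≤ ∫ g, |Gam (pot 1 B) (fun Q : Matrix (Fin N) (Fin N) ℂ => (Q * Δ * Q * Δ).trace.re) g| ∂ν := abs_integral_le_integral_abs
    _ ≤ ∫ g, (2 * matrixOpNorm B * frobNorm Δ ^ 2 + 2 / N * frobNorm Δ ^ 2 * |(B * (g : Matrix (Fin N) (Fin N) ℂ)).trace.im|) ∂ν :=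
        integral_mono (integrable_of_continuous_SUN hGc ν).abs iR fun g => abs_Gam_potB_quadDD_le hN B Δ g
    _ = 2 * matrixOpNorm B * frobNorm Δ ^ 2 + 2 / N * frobNorm Δ ^ 2 * ∫ g, |(B * (g : Matrix (Fin N) (Fin N) ℂ)).trace.im| ∂ν := by
        rw [integral_add (integrable_const _) (iX.const_mul _), integral_const_mul, integral_const_mul]
        simp
    _ ≤ _ := by
        have := mul_le_mul_of_nonneg_left hintz1 (by positivity : (0 : ℝ) ≤ 2 / N * frobNorm Δ ^ 2)
        linarith

/-- `|∫ Re(tr(gΔ)·tr(BgΔg)) dν_B| ≤ ‖B‖_F‖Δ‖_F Z₂`. [folklore] -/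
theorem abs_integral_zw_le (B Δ : Matrix (Fin N) (Fin N) ℂ) :
    |∫ g, ((((g : Matrix (Fin N) (Fin N) ℂ) * Δ).trace * (B * g * Δ * g).trace).re) ∂(haarProbability (SUN N)).tilted (fun g => (N : ℝ) * ((g : Matrix (Fin N) (Fin N) ℂ) * B).trace.re)| ≤
      frobNorm B * frobNorm Δ * Real.sqrt (∫ g, ‖((g : Matrix (Fin N) (Fin N) ℂ) * Δ).trace‖ ^ 2 ∂(haarProbability (SUN N)).tilted (fun g => (N : ℝ) * ((g : Matrix (Fin N) (Fin N) ℂ) * B).trace.re)) := by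
  have hB0 := frobNorm_nonneg B
  have hD0 := frobNorm_nonneg Δ
  set ν : Measure (SUN N) := (haarProbability (SUN N)).tilted (fun g => (N : ℝ) * ((g : Matrix (Fin N) (Fin N) ℂ) * B).trace.re) with hν
  have hexpi : Integrable (fun g : SUN N => Real.exp ((N : ℝ) * ((g : Matrix (Fin N) (Fin N) ℂ) * B).trace.re))
      (haarProbability (SUN N)) :=
    integrable_of_continuous_SUN (Real.continuous_exp.comp (continuous_restrict (contDiff_pot (N : ℝ) B))) _
  haveI : IsProbabilityMeasure ν := isProbabilityMeasure_tilted hexpi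
  have htr : Continuous fun g : SUN N => ((g : Matrix (Fin N) (Fin N) ℂ) * Δ).trace :=
    (continuous_subtype_val.matrix_mul continuous_const).matrix_trace
  have hz2c : Continuous fun g : SUN N => ‖((g : Matrix (Fin N) (Fin N) ℂ) * Δ).trace‖ := continuous_norm.comp htr
  have hwc : Continuous fun g : SUN N => (B * (g : Matrix (Fin N) (Fin N) ℂ) * Δ * (g : Matrix (Fin N) (Fin N) ℂ)).trace :=
    (((continuous_const.matrix_mul continuous_subtype_val).matrix_mul continuous_const).matrix_mul
      continuous_subtype_val).matrix_trace
  have hf1c : Continuous fun g : SUN N => ((((g : Matrix (Fin N) (Fin N) ℂ) * Δ).trace * (B * g * Δ * g).trace).re) :=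
    Complex.continuous_re.comp (htr.mul hwc)
  have hintz2 : ∫ g, ‖((g : Matrix (Fin N) (Fin N) ℂ) * Δ).trace‖ ∂ν ≤ Real.sqrt (∫ g, ‖((g : Matrix (Fin N) (Fin N) ℂ) * Δ).trace‖ ^ 2 ∂ν) := by
    have h := integral_abs_le_sqrt hz2c ν
    simp only [abs_norm] at h
    exact h
  have hb : ∀ g : SUN N, |((((g : Matrix (Fin N) (Fin N) ℂ) * Δ).trace * (B * g * Δ * g).trace).re)| ≤
      frobNorm B * frobNorm Δ * ‖((g : Matrix (Fin N) (Fin N) ℂ) * Δ).trace‖ := by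
    intro g
    have hg := SUN.mem_unitaryGroup g
    refine (abs_re_mul_le_norm_mul_norm _ _).trans ?_
    have hw : ‖(B * (g : Matrix (Fin N) (Fin N) ℂ) * Δ * (g : Matrix (Fin N) (Fin N) ℂ)).trace‖ ≤ frobNorm B * frobNorm Δ := by
      rw [show B * (g : Matrix (Fin N) (Fin N) ℂ) * Δ * (g : Matrix (Fin N) (Fin N) ℂ) =
        (B * (g : Matrix (Fin N) (Fin N) ℂ)) * (Δ * (g : Matrix (Fin N) (Fin N) ℂ)) by simp only [Matrix.mul_assoc]]
      refine (norm_trace_mul_le _ _).trans ?_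
      rw [frobNorm_mul_unitary _ hg, frobNorm_mul_unitary _ hg]
    calc ‖((g : Matrix (Fin N) (Fin N) ℂ) * Δ).trace‖ * ‖(B * (g : Matrix (Fin N) (Fin N) ℂ) * Δ * (g : Matrix (Fin N) (Fin N) ℂ)).trace‖
        ≤ ‖((g : Matrix (Fin N) (Fin N) ℂ) * Δ).trace‖ * (frobNorm B * frobNorm Δ) := mul_le_mul_of_nonneg_left hw (norm_nonneg _)
      _ = _ := by ring
  refine (abs_integral_le_integral_abs).trans ?_
  calc ∫ g, |((((g : Matrix (Fin N) (Fin N) ℂ) * Δ).trace * (B * g * Δ * g).trace).re)| ∂ν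
      ≤ ∫ g, frobNorm B * frobNorm Δ * ‖((g : Matrix (Fin N) (Fin N) ℂ) * Δ).trace‖ ∂ν :=
        integral_mono (integrable_of_continuous_SUN hf1c ν).abs ((integrable_of_continuous_SUN hz2c ν).const_mul _) hb
    _ = frobNorm B * frobNorm Δ * ∫ g, ‖((g : Matrix (Fin N) (Fin N) ℂ) * Δ).trace‖ ∂ν := integral_const_mul _ _
    _ ≤ _ := mul_le_mul_of_nonneg_left hintz2 (mul_nonneg hB0 hD0)

/-- `|∫ Im tr(Bg) Im(tr(gΔ)²) dν_B| ≤ N‖B‖_op Z₂²`. [folklore] -/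
theorem abs_integral_Xzz_le (hN : N ≠ 0) (B Δ : Matrix (Fin N) (Fin N) ℂ) :
    |∫ g, (B * (g : Matrix (Fin N) (Fin N) ℂ)).trace.im *
        (((g : Matrix (Fin N) (Fin N) ℂ) * Δ).trace * ((g : Matrix (Fin N) (Fin N) ℂ) * Δ).trace).im ∂(haarProbability (SUN N)).tilted (fun g => (N : ℝ) * ((g : Matrix (Fin N) (Fin N) ℂ) * B).trace.re)| ≤
      N * matrixOpNorm B * (Real.sqrt (∫ g, ‖((g : Matrix (Fin N) (Fin N) ℂ) * Δ).trace‖ ^ 2 ∂(haarProbability (SUN N)).tilted (fun g => (N : ℝ) * ((g : Matrix (Fin N) (Fin N) ℂ) * B).trace.re))) ^ 2 := by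
  have hNpos : (0 : ℝ) < N := Nat.cast_pos.2 (Nat.pos_of_ne_zero hN)
  have hr0 := matrixOpNorm_nonneg B
  set ν : Measure (SUN N) := (haarProbability (SUN N)).tilted (fun g => (N : ℝ) * ((g : Matrix (Fin N) (Fin N) ℂ) * B).trace.re) with hν
  have hexpi : Integrable (fun g : SUN N => Real.exp ((N : ℝ) * ((g : Matrix (Fin N) (Fin N) ℂ) * B).trace.re))
      (haarProbability (SUN N)) :=
    integrable_of_continuous_SUN (Real.continuous_exp.comp (continuous_restrict (contDiff_pot (N : ℝ) B))) _
  haveI : IsProbabilityMeasure ν := isProbabilityMeasure_tilted hexpi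
  have htr : Continuous fun g : SUN N => ((g : Matrix (Fin N) (Fin N) ℂ) * Δ).trace :=
    (continuous_subtype_val.matrix_mul continuous_const).matrix_trace
  have hz2c : Continuous fun g : SUN N => ‖((g : Matrix (Fin N) (Fin N) ℂ) * Δ).trace‖ := continuous_norm.comp htr
  have hXc : Continuous fun g : SUN N => (B * (g : Matrix (Fin N) (Fin N) ℂ)).trace.im :=
    Complex.continuous_im.comp ((continuous_const.matrix_mul continuous_subtype_val).matrix_trace)
  have hf4c : Continuous fun g : SUN N => (B * (g : Matrix (Fin N) (Fin N) ℂ)).trace.im *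
      (((g : Matrix (Fin N) (Fin N) ℂ) * Δ).trace * ((g : Matrix (Fin N) (Fin N) ℂ) * Δ).trace).im :=
    hXc.mul (Complex.continuous_im.comp (htr.mul htr))
  have hb : ∀ g : SUN N, |(B * (g : Matrix (Fin N) (Fin N) ℂ)).trace.im *
      (((g : Matrix (Fin N) (Fin N) ℂ) * Δ).trace * ((g : Matrix (Fin N) (Fin N) ℂ) * Δ).trace).im| ≤
      N * matrixOpNorm B * ‖((g : Matrix (Fin N) (Fin N) ℂ) * Δ).trace‖ ^ 2 := by
    intro g
    rw [abs_mul]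
    refine mul_le_mul (abs_im_trace_mul_su_le B g) ((abs_im_le_norm' _).trans ?_) (abs_nonneg _) (by positivity)
    rw [norm_mul, sq]
  have step1 : ∫ g, |(B * (g : Matrix (Fin N) (Fin N) ℂ)).trace.im *
      (((g : Matrix (Fin N) (Fin N) ℂ) * Δ).trace * ((g : Matrix (Fin N) (Fin N) ℂ) * Δ).trace).im| ∂ν ≤
      ∫ g, N * matrixOpNorm B * ‖((g : Matrix (Fin N) (Fin N) ℂ) * Δ).trace‖ ^ 2 ∂ν :=
    integral_mono (integrable_of_continuous_SUN hf4c ν).abs ((integrable_of_continuous_SUN (hz2c.pow 2) ν).const_mul _) hb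
  have step2 : ∫ g, N * matrixOpNorm B * ‖((g : Matrix (Fin N) (Fin N) ℂ) * Δ).trace‖ ^ 2 ∂ν =
      N * matrixOpNorm B * ∫ g, ‖((g : Matrix (Fin N) (Fin N) ℂ) * Δ).trace‖ ^ 2 ∂ν := integral_const_mul _ _
  have hsq : Real.sqrt (∫ g, ‖((g : Matrix (Fin N) (Fin N) ℂ) * Δ).trace‖ ^ 2 ∂ν) ^ 2 =
      ∫ g, ‖((g : Matrix (Fin N) (Fin N) ℂ) * Δ).trace‖ ^ 2 ∂ν := Real.sq_sqrt (integral_nonneg fun g => sq_nonneg _)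
  rw [hsq]
  exact (abs_integral_le_integral_abs).trans (step1.trans step2.le)

/-- `|∫ Γ(Re tr(·B), Re(tr(QΔ)²)) dν_B| ≤ ‖B‖_F‖Δ‖_F Z₂ + ‖B‖_F‖Δ‖_F A_Δ + 2‖B‖_op Z₂²`. [folklore] -/
theorem abs_integral_Gam_potB_prodDD_le (hN : N ≠ 0) (B Δ : Matrix (Fin N) (Fin N) ℂ) :
    |∫ g, Gam (pot 1 B) (fun Q : Matrix (Fin N) (Fin N) ℂ => ((Q * Δ).trace * (Q * Δ).trace).re) g ∂(haarProbability (SUN N)).tilted (fun g => (N : ℝ) * ((g : Matrix (Fin N) (Fin N) ℂ) * B).trace.re)| ≤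
      frobNorm B * frobNorm Δ * Real.sqrt (∫ g, ‖((g : Matrix (Fin N) (Fin N) ℂ) * Δ).trace‖ ^ 2 ∂(haarProbability (SUN N)).tilted (fun g => (N : ℝ) * ((g : Matrix (Fin N) (Fin N) ℂ) * B).trace.re))
        + frobNorm B * frobNorm Δ *
          Real.sqrt ((∫ g, ((g : Matrix (Fin N) (Fin N) ℂ) * Δ).trace.re ∂(haarProbability (SUN N)).tilted (fun g => (N : ℝ) * ((g : Matrix (Fin N) (Fin N) ℂ) * B).trace.re)) ^ 2
            + (∫ g, ((g : Matrix (Fin N) (Fin N) ℂ) * Δ).trace.im ∂(haarProbability (SUN N)).tilted (fun g => (N : ℝ) * ((g : Matrix (Fin N) (Fin N) ℂ) * B).trace.re)) ^ 2)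
        + 2 * matrixOpNorm B * (Real.sqrt (∫ g, ‖((g : Matrix (Fin N) (Fin N) ℂ) * Δ).trace‖ ^ 2 ∂(haarProbability (SUN N)).tilted (fun g => (N : ℝ) * ((g : Matrix (Fin N) (Fin N) ℂ) * B).trace.re))) ^ 2 := by
  have hNpos : (0 : ℝ) < N := Nat.cast_pos.2 (Nat.pos_of_ne_zero hN)
  have hB0 := frobNorm_nonneg B
  have hD0 := frobNorm_nonneg Δ
  set r : ℝ := matrixOpNorm B with hr
  have hr0 : 0 ≤ r := matrixOpNorm_nonneg B
  set ν : Measure (SUN N) := (haarProbability (SUN N)).tilted (fun g => (N : ℝ) * ((g : Matrix (Fin N) (Fin N) ℂ) * B).trace.re) with hν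
  have hexpi : Integrable (fun g : SUN N => Real.exp ((N : ℝ) * ((g : Matrix (Fin N) (Fin N) ℂ) * B).trace.re))
      (haarProbability (SUN N)) :=
    integrable_of_continuous_SUN (Real.continuous_exp.comp (continuous_restrict (contDiff_pot (N : ℝ) B))) _
  haveI : IsProbabilityMeasure ν := isProbabilityMeasure_tilted hexpi
  set Z₂ : ℝ := Real.sqrt (∫ g, ‖((g : Matrix (Fin N) (Fin N) ℂ) * Δ).trace‖ ^ 2 ∂ν) with hZ₂
  set aΔ : ℝ := ∫ g, ((g : Matrix (Fin N) (Fin N) ℂ) * Δ).trace.re ∂ν with haΔ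
  set bΔ : ℝ := ∫ g, ((g : Matrix (Fin N) (Fin N) ℂ) * Δ).trace.im ∂ν with hbΔ
  set AΔ : ℝ := Real.sqrt (aΔ ^ 2 + bΔ ^ 2) with hAΔ
  have htr : ∀ M : Matrix (Fin N) (Fin N) ℂ, Continuous fun g : SUN N => ((g : Matrix (Fin N) (Fin N) ℂ) * M).trace :=
    fun M => (continuous_subtype_val.matrix_mul continuous_const).matrix_trace
  have hz2c : Continuous fun g : SUN N => ‖((g : Matrix (Fin N) (Fin N) ℂ) * Δ).trace‖ := continuous_norm.comp (htr Δ)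
  -- pointwise closed form
  have hpt : ∀ g : SUN N, Gam (pot 1 B) (fun Q : Matrix (Fin N) (Fin N) ℂ => ((Q * Δ).trace * (Q * Δ).trace).re) g =
      -((((g : Matrix (Fin N) (Fin N) ℂ) * Δ).trace * (B * g * Δ * g).trace).re)
        + ((Δ * Bᴴ).trace.re * ((g : Matrix (Fin N) (Fin N) ℂ) * Δ).trace.re
            - (Δ * Bᴴ).trace.im * ((g : Matrix (Fin N) (Fin N) ℂ) * Δ).trace.im)
        - 2 / N * ((B * (g : Matrix (Fin N) (Fin N) ℂ)).trace.im *
            (((g : Matrix (Fin N) (Fin N) ℂ) * Δ).trace * ((g : Matrix (Fin N) (Fin N) ℂ) * Δ).trace).im) := by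
    intro g
    rw [Gam_potB_reTrProd hN B Δ Δ g]
    simp only [mul_re]
    ring
  set f1 : SUN N → ℝ := fun g => (((g : Matrix (Fin N) (Fin N) ℂ) * Δ).trace * (B * g * Δ * g).trace).re with hf1
  set f2 : SUN N → ℝ := fun g => ((g : Matrix (Fin N) (Fin N) ℂ) * Δ).trace.re with hf2
  set f3 : SUN N → ℝ := fun g => ((g : Matrix (Fin N) (Fin N) ℂ) * Δ).trace.im with hf3
  set f4 : SUN N → ℝ := fun g => (B * (g : Matrix (Fin N) (Fin N) ℂ)).trace.im *
    (((g : Matrix (Fin N) (Fin N) ℂ) * Δ).trace * ((g : Matrix (Fin N) (Fin N) ℂ) * Δ).trace).im with hf4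
  have hwc : Continuous fun g : SUN N => (B * (g : Matrix (Fin N) (Fin N) ℂ) * Δ * (g : Matrix (Fin N) (Fin N) ℂ)).trace :=
    (((continuous_const.matrix_mul continuous_subtype_val).matrix_mul continuous_const).matrix_mul
      continuous_subtype_val).matrix_trace
  have hf1c : Continuous f1 := Complex.continuous_re.comp ((htr Δ).mul hwc)
  have hf2c : Continuous f2 := Complex.continuous_re.comp (htr Δ)
  have hf3c : Continuous f3 := Complex.continuous_im.comp (htr Δ)
  have hXc : Continuous fun g : SUN N => (B * (g : Matrix (Fin N) (Fin N) ℂ)).trace.im :=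
    Complex.continuous_im.comp ((continuous_const.matrix_mul continuous_subtype_val).matrix_trace)
  have hf4c : Continuous f4 := hXc.mul (Complex.continuous_im.comp ((htr Δ).mul (htr Δ)))
  have i1 : Integrable f1 ν := integrable_of_continuous_SUN hf1c ν
  have i2 : Integrable f2 ν := integrable_of_continuous_SUN hf2c ν
  have i3 : Integrable f3 ν := integrable_of_continuous_SUN hf3c ν
  have i4 : Integrable f4 ν := integrable_of_continuous_SUN hf4c ν
  have hsplit : ∫ g, Gam (pot 1 B) (fun Q : Matrix (Fin N) (Fin N) ℂ => ((Q * Δ).trace * (Q * Δ).trace).re) g ∂ν =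
      -∫ g, f1 g ∂ν + ((Δ * Bᴴ).trace.re * aΔ - (Δ * Bᴴ).trace.im * bΔ) - 2 / N * ∫ g, f4 g ∂ν := by
    simp_rw [hpt]
    have i23 : Integrable (fun g => (Δ * Bᴴ).trace.re * f2 g - (Δ * Bᴴ).trace.im * f3 g) ν :=
      (i2.const_mul _).sub (i3.const_mul _)
    have i1n : Integrable (fun g => -f1 g) ν := i1.neg
    have i123 : Integrable (fun g => -f1 g + ((Δ * Bᴴ).trace.re * f2 g - (Δ * Bᴴ).trace.im * f3 g)) ν := i1n.add i23
    have e : (fun g : SUN N => -((((g : Matrix (Fin N) (Fin N) ℂ) * Δ).trace * (B * g * Δ * g).trace).re)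
        + ((Δ * Bᴴ).trace.re * ((g : Matrix (Fin N) (Fin N) ℂ) * Δ).trace.re
            - (Δ * Bᴴ).trace.im * ((g : Matrix (Fin N) (Fin N) ℂ) * Δ).trace.im)
        - 2 / N * ((B * (g : Matrix (Fin N) (Fin N) ℂ)).trace.im *
            (((g : Matrix (Fin N) (Fin N) ℂ) * Δ).trace * ((g : Matrix (Fin N) (Fin N) ℂ) * Δ).trace).im)) =
        fun g => (-f1 g + ((Δ * Bᴴ).trace.re * f2 g - (Δ * Bᴴ).trace.im * f3 g)) - 2 / N * f4 g := by
      funext g; simp only [hf1, hf2, hf3, hf4]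
    rw [e, integral_sub i123 (i4.const_mul _), integral_add i1n i23, integral_neg,
      integral_sub (i2.const_mul _) (i3.const_mul _), integral_const_mul, integral_const_mul, integral_const_mul]
  have q1 : |∫ g, f1 g ∂ν| ≤ frobNorm B * frobNorm Δ * Z₂ := abs_integral_zw_le B Δ
  have q2 : |(Δ * Bᴴ).trace.re * aΔ - (Δ * Bᴴ).trace.im * bΔ| ≤ frobNorm B * frobNorm Δ * AΔ := by
    have e : (Δ * Bᴴ).trace.re * aΔ - (Δ * Bᴴ).trace.im * bΔ = ((Δ * Bᴴ).trace * (⟨aΔ, bΔ⟩ : ℂ)).re := by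
      simp [mul_re]
    rw [e]
    refine (abs_re_mul_le_norm_mul_norm _ _).trans ?_
    have hτ : ‖(Δ * Bᴴ).trace‖ ≤ frobNorm Δ * frobNorm B := by
      have h := norm_trace_mul_le Δ Bᴴ; rwa [frobNorm_conjTranspose] at h
    have hc : ‖(⟨aΔ, bΔ⟩ : ℂ)‖ = AΔ := by
      rw [hAΔ, Complex.norm_def, Complex.normSq_apply]; simp [sq]
    rw [hc]
    calc ‖(Δ * Bᴴ).trace‖ * AΔ ≤ frobNorm Δ * frobNorm B * AΔ := mul_le_mul_of_nonneg_right hτ (Real.sqrt_nonneg _)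
      _ = _ := by ring
  have q3 : |∫ g, f4 g ∂ν| ≤ N * r * Z₂ ^ 2 := abs_integral_Xzz_le hN B Δ
  rw [hsplit]
  have hNr : 0 ≤ 2 / (N : ℝ) := by positivity
  calc |-∫ g, f1 g ∂ν + ((Δ * Bᴴ).trace.re * aΔ - (Δ * Bᴴ).trace.im * bΔ) - 2 / N * ∫ g, f4 g ∂ν|
      ≤ |-∫ g, f1 g ∂ν| + |(Δ * Bᴴ).trace.re * aΔ - (Δ * Bᴴ).trace.im * bΔ| + |2 / N * ∫ g, f4 g ∂ν| :=
        (abs_sub _ _).trans (add_le_add (abs_add_le _ _) le_rfl)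
    _ ≤ frobNorm B * frobNorm Δ * Z₂ + frobNorm B * frobNorm Δ * AΔ + 2 / N * (N * r * Z₂ ^ 2) := by
        rw [abs_neg, abs_mul, abs_of_nonneg hNr]
        exact add_le_add (add_le_add q1 q2) (mul_le_mul_of_nonneg_left q3 hNr)
    _ = _ := by field_simp

/-- **The quadratic mean `E Re tr(gΔgΔ)` (primitive `ω`), `N ≥ 3`**: with `a = 2N − 4/N`, `Z₁, Z₂, A_Δ` as in the module docstring,
`|E Re tr(gΔgΔ)| ≤ (Na/(a²−4))(2r‖Δ‖_F² + (2/N)‖Δ‖_F² Z₁) + (2N/(a²−4))(‖B‖_F‖Δ‖_F Z₂ + ‖B‖_F‖Δ‖_F A_Δ + 2r Z₂²)`. [folklore] -/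
theorem abs_integral_reTrQuad_DD_le (hN : 3 ≤ N) (B Δ : Matrix (Fin N) (Fin N) ℂ) :
    |∫ g, ((g : Matrix (Fin N) (Fin N) ℂ) * Δ * g * Δ).trace.re ∂(haarProbability (SUN N)).tilted (fun g => (N : ℝ) * ((g : Matrix (Fin N) (Fin N) ℂ) * B).trace.re)| ≤
      (N : ℝ) * (2 * (N : ℝ) - 4 / N) / ((2 * (N : ℝ) - 4 / N) ^ 2 - 4) *
          (2 * matrixOpNorm B * frobNorm Δ ^ 2 + 2 / N * frobNorm Δ ^ 2 *
            Real.sqrt (∫ g, ‖((g : Matrix (Fin N) (Fin N) ℂ) * B).trace‖ ^ 2 ∂(haarProbability (SUN N)).tilted (fun g => (N : ℝ) * ((g : Matrix (Fin N) (Fin N) ℂ) * B).trace.re)))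
        + 2 * (N : ℝ) / ((2 * (N : ℝ) - 4 / N) ^ 2 - 4) *
          (frobNorm B * frobNorm Δ * Real.sqrt (∫ g, ‖((g : Matrix (Fin N) (Fin N) ℂ) * Δ).trace‖ ^ 2 ∂(haarProbability (SUN N)).tilted (fun g => (N : ℝ) * ((g : Matrix (Fin N) (Fin N) ℂ) * B).trace.re))
            + frobNorm B * frobNorm Δ *
              Real.sqrt ((∫ g, ((g : Matrix (Fin N) (Fin N) ℂ) * Δ).trace.re ∂(haarProbability (SUN N)).tilted (fun g => (N : ℝ) * ((g : Matrix (Fin N) (Fin N) ℂ) * B).trace.re)) ^ 2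
                + (∫ g, ((g : Matrix (Fin N) (Fin N) ℂ) * Δ).trace.im ∂(haarProbability (SUN N)).tilted (fun g => (N : ℝ) * ((g : Matrix (Fin N) (Fin N) ℂ) * B).trace.re)) ^ 2)
            + 2 * matrixOpNorm B * (Real.sqrt (∫ g, ‖((g : Matrix (Fin N) (Fin N) ℂ) * Δ).trace‖ ^ 2 ∂(haarProbability (SUN N)).tilted (fun g => (N : ℝ) * ((g : Matrix (Fin N) (Fin N) ℂ) * B).trace.re))) ^ 2) := by
  have hN0 : N ≠ 0 := by omega
  have h3 : (3 : ℝ) ≤ N := by exact_mod_cast hN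
  have hNpos : (0 : ℝ) < N := by linarith
  set a : ℝ := 2 * (N : ℝ) - 4 / N with ha
  have ha4 : 4 < a := by
    have : (4 : ℝ) / N ≤ 4 / 3 := by rw [div_le_div_iff₀ hNpos (by norm_num)]; linarith
    rw [ha]; linarith
  have ha0 : 0 < a := by linarith
  have hden : 0 < a ^ 2 - 4 := by nlinarith
  have hSD := integral_reTrQuad_eq hN B Δ Δ (N := N)
  rw [← ha] at hSD
  have hGw := abs_integral_Gam_potB_quadDD_le hN0 B Δ (N := N)
  have hGt := abs_integral_Gam_potB_prodDD_le hN0 B Δ (N := N)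
  set Gw : ℝ := ∫ g, Gam (pot 1 B) (fun Q : Matrix (Fin N) (Fin N) ℂ => (Q * Δ * Q * Δ).trace.re) g ∂(haarProbability (SUN N)).tilted (fun g => (N : ℝ) * ((g : Matrix (Fin N) (Fin N) ℂ) * B).trace.re) with hGwdef
  set Gt : ℝ := ∫ g, Gam (pot 1 B) (fun Q : Matrix (Fin N) (Fin N) ℂ => ((Q * Δ).trace * (Q * Δ).trace).re) g ∂(haarProbability (SUN N)).tilted (fun g => (N : ℝ) * ((g : Matrix (Fin N) (Fin N) ℂ) * B).trace.re) with hGtdef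
  have hI : ∫ g, ((g : Matrix (Fin N) (Fin N) ℂ) * Δ * g * Δ).trace.re ∂(haarProbability (SUN N)).tilted (fun g => (N : ℝ) * ((g : Matrix (Fin N) (Fin N) ℂ) * B).trace.re) = (N : ℝ) * (a * Gw - 2 * Gt) / (a ^ 2 - 4) := by
    rw [eq_div_iff hden.ne']; linarith [hSD]
  rw [hI, abs_div, abs_of_pos hden, abs_mul, abs_of_pos hNpos, div_le_iff₀ hden]
  have h1 : |a * Gw - 2 * Gt| ≤ a * |Gw| + 2 * |Gt| := by
    refine (abs_sub _ _).trans ?_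
    rw [abs_mul, abs_mul, abs_of_pos ha0, abs_of_pos (by norm_num : (0 : ℝ) < 2)]
  have h2 := mul_le_mul_of_nonneg_left hGw ha0.le
  have h3 := mul_le_mul_of_nonneg_left hGt (by norm_num : (0 : ℝ) ≤ 2)
  have key : (N : ℝ) * |a * Gw - 2 * Gt| ≤ (N : ℝ) * (a * |Gw| + 2 * |Gt|) := mul_le_mul_of_nonneg_left h1 hNpos.le
  refine key.trans ?_
  refine (mul_le_mul_of_nonneg_left (add_le_add h2 h3) hNpos.le).trans (le_of_eq ?_)
  field_simp

end Summit.Ventures.YMGap.OneLinkEigen
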